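import Literature.Probability.LatticeModels.DobrushinShlosmanWeightedInfiniteVolumeStates
import HarnessLib

/-!
# The weighted Dobrushin–Shlosman window comparison (arbitrary range) for a PAIR of measures: a Gibbs
# measure of `γ` against a measure that is DLR only for the usable windows (two specifications agreeing
# away from a defect region)

Topic `Literature/Probability/LatticeModels`; theorems only (no definitions, no named facts). The arbitrary-range
(weighted received sums) twin of `DobrushinShlosmanGibbsPair.lean`: the two-functional engine
`abs_sub_le_window_weighted_infinite` of `DobrushinShlosmanWeightedInfiniteVolume.lean` (Dobrushin–Shlosman 1985,
Theorem 1, in the Vasserstein form of Föllmer 1988 Ch. I (2.7)–(2.10), with Cor. (2.14) / Georgii 2011 Remark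
8.26 for windows of infinite range) is run with

* `E₁ = μ`, a Gibbs measure of the specification `γ` carrying the window data (site weight `0 ≤ r ≤ R` with
  `r a a = 0`, windows `win c`, array `K ≥ 0` with the GLOBAL window contraction (H1) and the WEIGHTED received
  sums (H2) `Σ'_y K(c; y → x) e^{t d(c; y, x)} ≤ γ₀ < 1`), and
* `E₂ = ν`, ANY probability measure satisfying the DLR equation `ν(γ_{win c} G) = ν(G)` for the windows of the
  USABLE centres (`c ∈ Λ`, `win c ⊆ Λ`, `P c`) only

(`abs_integral_sub_integral_le_window_weighted_of_dlrOn`): for a bounded measurable `f` reading `Δf ⊆ Λ` with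
site-Lipschitz vector `δf`, and a real profile `ρ` (`≤ 0` off `Λ` and on the sites of `Λ` in no usable window,
`ρ x ≤ ρ y + d(c; y, x)` along the usable windows):

  `|∫ f dμ − ∫ f dν| ≤ R Σ_{x ∈ Δf} e^{−t ρ(x)} δf x`.

The case of record (`abs_integral_sub_integral_le_window_weighted_pair`, `_pair_exp`): `ν` is a Gibbs measure
of a SECOND specification `γ'` whose window kernels COINCIDE with those of `γ` at the usable centres — Föllmer's
comparison of two specifications (1988, Ch. I, Comparison Theorem (2.8) with the localisation (2.10)) in the
weighted Dobrushin–Shlosman window setting: with `ρ ≥ m` on `Δf`, `|∫ f dμ − ∫ f dν| ≤ R e^{−t m} Σ_{Δf} δf`.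
Typical use: `γ'` = the specification of a locally modified interaction of infinite range (a source supported in
a finite region `S`), usable = windows not reading `S`; the bound is the exponential SCREENING of the source in
every DLR state, with a constant that does not see the size of the modification.

References: R. L. Dobrushin, S. B. Shlosman (1985), Thm. 1; H. Föllmer, LNM 1362 (1988), Ch. I, (2.7)–(2.10),
Thm. (2.8), Cor. (2.14); H.-O. Georgii (2011), Remark 8.26; the tree files
`DobrushinShlosmanWeightedInfiniteVolume(States).lean` (followed line by line), `DobrushinShlosmanGibbsPair.lean`.
-/

noncomputable section

open MeasureTheory ProbabilityTheory Finset Function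
open Literature.Probability.LatticeModels.DobrushinMetric (IsLipBound integrable_of_abs_le')

namespace Literature.Probability.LatticeModels.DobrushinShlosman

variable {V S : Type*} [MeasurableSpace S]

/-- **The weighted Dobrushin–Shlosman window comparison (arbitrary range): a Gibbs measure against a measure
that is DLR on the usable windows** (Dobrushin–Shlosman 1985, Theorem 1, Vasserstein form; Föllmer 1988 Ch. I
(2.7)–(2.10), Cor. (2.14); Georgii 2011 Remark 8.26). Window data of `γ` as in
`abs_sub_le_window_weighted_infinite` / `abs_covariance_le_of_window_weighted`; `μ` a Gibbs measure of `γ`;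
`ν` a probability measure with `∫ (γ_{win c} G) dν = ∫ G dν` for every bounded measurable `G` and every USABLE
centre (`c ∈ Λ`, `win c ⊆ Λ`, `P c`); `f` bounded measurable reading `Δf ⊆ Λ` with site-Lipschitz vector `δf`;
`ρ` a real profile, `≤ 0` off `Λ` and on the sites of `Λ` lying in no usable window, with
`ρ x ≤ ρ y + d(c; y, x)` whenever a usable window `win c ∋ x` receives influence from `y`. Then
`|∫ f dμ − ∫ f dν| ≤ R Σ_{x ∈ Δf} e^{−t ρ(x)} δf x`.
[cite: DobrushinShlosman1985, Theorem 1] -/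
theorem abs_integral_sub_integral_le_window_weighted_of_dlrOn [DecidableEq V] {γ : Specification V S}
    (hγ : IsSpecification γ)
    {r : S → S → ℝ} {R : ℝ} (hr0 : ∀ a b, 0 ≤ r a b) (hrR : ∀ a b, r a b ≤ R) (hR : 0 ≤ R)
    (hrr : ∀ a, r a a = 0)
    {win : V → Finset V} {K : V → V → V → ℝ} (hK0 : ∀ c y x, 0 ≤ K c y x)
    (hcontract : ∀ (c : V) (ω η : V → S) (f : (V → S) → ℝ) (δ : V → ℝ), Measurable f →
      (∃ B, ∀ σ, |f σ| ≤ B) → DependsOn f (win c : Set V) → (∀ x, 0 ≤ δ x) →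
      (∀ (x : V) (σ τ : V → S), (∀ v, v ≠ x → σ v = τ v) → |f σ - f τ| ≤ δ x * r (σ x) (τ x)) →
        |∫ σ, f σ ∂(γ (win c) ω) - ∫ σ, f σ ∂(γ (win c) η)| ≤
          ∑ x ∈ win c, δ x * ∑' y, K c y x * r (ω y) (η y))
    {t : ℝ} (ht : 0 ≤ t) {d : V → V → V → ℝ} (hd0 : ∀ c y x, 0 ≤ d c y x)
    (hKs : ∀ c x, Summable fun y => K c y x * Real.exp (t * d c y x))
    {γ₀ : ℝ} (hγ₀ : 0 ≤ γ₀) (hγ₁ : γ₀ < 1)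
    (hsumW : ∀ c, ∀ x ∈ win c, ∑' y, K c y x * Real.exp (t * d c y x) ≤ γ₀)
    {μ : Measure (V → S)} (hμ : IsGibbsMeasure γ μ)
    {ν : Measure (V → S)} [IsProbabilityMeasure ν] (Λ : Finset V) (P : V → Prop)
    (hν : ∀ c ∈ Λ, win c ⊆ Λ → P c → ∀ ⦃G : (V → S) → ℝ⦄, Measurable G → (∃ B, ∀ σ, |G σ| ≤ B) →
      ∫ σ, (∫ τ, G τ ∂(γ (win c) σ)) ∂ν = ∫ σ, G σ ∂ν)
    {f : (V → S) → ℝ} (hfm : Measurable f) {Bf : ℝ} (hBf : ∀ σ, |f σ| ≤ Bf)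
    {Δf : Finset V} (hfdep : DependsOn f (Δf : Set V)) {δf : V → ℝ} (hδf : IsLipBound r f δf)
    (hΔf : Δf ⊆ Λ) (ρ : V → ℝ) (hρout : ∀ y, y ∉ Λ → ρ y ≤ 0)
    (hρunc : ∀ x ∈ Λ, (∀ c ∈ Λ, win c ⊆ Λ → P c → x ∉ win c) → ρ x ≤ 0)
    (hρ : ∀ c ∈ Λ, win c ⊆ Λ → P c → ∀ x ∈ win c, ∀ y, K c y x ≠ 0 → ρ x ≤ ρ y + d c y x) :
    |∫ σ, f σ ∂μ - ∫ σ, f σ ∂ν| ≤ R * ∑ x ∈ Δf, Real.exp (-(t * ρ x)) * δf x := by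
  -- adapted from `DobrushinShlosman.abs_covariance_le_of_window_weighted` (the two functionals are two measures)
  classical
  haveI := hμ.isProbabilityMeasure
  have h₁le : ∀ ⦃F : (V → S) → ℝ⦄ ⦃M : ℝ⦄, Measurable F → (∃ B, ∀ σ, |F σ| ≤ B) →
      (∀ σ, F σ ≤ M) → ∫ σ, F σ ∂μ ≤ M := by
    rintro F M hFm ⟨B, hB⟩ hM
    calc ∫ σ, F σ ∂μ ≤ ∫ _σ, M ∂μ := integral_mono (integrable_of_abs_le' hFm hB) (integrable_const M) hM
      _ = M := by simp
  have h₁ge : ∀ ⦃F : (V → S) → ℝ⦄ ⦃M : ℝ⦄, Measurable F → (∃ B, ∀ σ, |F σ| ≤ B) →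
      (∀ σ, M ≤ F σ) → M ≤ ∫ σ, F σ ∂μ := by
    rintro F M hFm ⟨B, hB⟩ hM
    calc M = ∫ _σ, M ∂μ := by simp
      _ ≤ ∫ σ, F σ ∂μ := integral_mono (integrable_const M) (integrable_of_abs_le' hFm hB) hM
  have h₁T : ∀ c ∈ Λ, win c ⊆ Λ → P c → ∀ ⦃F : (V → S) → ℝ⦄, Measurable F →
      (∃ B, ∀ σ, |F σ| ≤ B) → ∫ σ, (fun σ => ∫ τ, F τ ∂(γ (win c) σ)) σ ∂μ = ∫ σ, F σ ∂μ := by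
    rintro c - - - F hFm ⟨B, hB⟩
    exact hμ.integral_integral_eq hγ (win c) (integrable_of_abs_le' hFm hB)
  have h₂le : ∀ ⦃F : (V → S) → ℝ⦄ ⦃M : ℝ⦄, Measurable F → (∃ B, ∀ σ, |F σ| ≤ B) →
      (∀ σ, F σ ≤ M) → ∫ σ, F σ ∂ν ≤ M := by
    rintro F M hFm ⟨B, hB⟩ hM
    calc ∫ σ, F σ ∂ν ≤ ∫ _σ, M ∂ν := integral_mono (integrable_of_abs_le' hFm hB) (integrable_const M) hM
      _ = M := by simp
  have h₂ge : ∀ ⦃F : (V → S) → ℝ⦄ ⦃M : ℝ⦄, Measurable F → (∃ B, ∀ σ, |F σ| ≤ B) →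
      (∀ σ, M ≤ F σ) → M ≤ ∫ σ, F σ ∂ν := by
    rintro F M hFm ⟨B, hB⟩ hM
    calc M = ∫ _σ, M ∂ν := by simp
      _ ≤ ∫ σ, F σ ∂ν := integral_mono (integrable_const M) (integrable_of_abs_le' hFm hB) hM
  have h₂T : ∀ c ∈ Λ, win c ⊆ Λ → P c → ∀ ⦃F : (V → S) → ℝ⦄, Measurable F →
      (∃ B, ∀ σ, |F σ| ≤ B) → ∫ σ, (fun σ => ∫ τ, F τ ∂(γ (win c) σ)) σ ∂ν = ∫ σ, F σ ∂ν :=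
    fun c hc hw hP F hFm hFb => hν c hc hw hP hFm hFb
  -- the two-functional comparison for `f`, with its Lipschitz vector cut down to `Δf`
  have hfdepΛ : DependsOn f (Λ : Set V) :=
    hfdep.mono fun v hv => Finset.mem_coe.2 (hΔf (Finset.mem_coe.1 hv))
  have key := abs_sub_le_window_weighted_infinite hγ hr0 hrR hR hrr hK0 hcontract ht hd0 hKs hγ₀ hγ₁ hsumW Λ
    P (E₁ := fun F => ∫ σ, F σ ∂μ) (E₂ := fun F => ∫ σ, F σ ∂ν) h₁le h₁ge h₁T h₂le h₂ge h₂T ρ hρout hρunc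
    hρ hfm hBf hfdepΛ (hδf.restrict hfdep)
  have hsumΔ : ∑ x ∈ Λ, Real.exp (-(t * ρ x)) * (if x ∈ Δf then δf x else 0) =
      ∑ x ∈ Δf, Real.exp (-(t * ρ x)) * δf x := by
    have h1 : ∑ x ∈ Λ, Real.exp (-(t * ρ x)) * (if x ∈ Δf then δf x else 0) =
        ∑ x ∈ Λ, (if x ∈ Δf then Real.exp (-(t * ρ x)) * δf x else 0) :=
      Finset.sum_congr rfl fun x _ => by split_ifs <;> simp
    rw [h1, Finset.sum_ite_mem, Finset.inter_eq_right.2 hΔf]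
  rw [hsumΔ] at key
  exact key

/-- **The weighted Dobrushin–Shlosman window comparison (arbitrary range) for TWO SPECIFICATIONS whose window
kernels agree at the usable centres** (Föllmer 1988 Ch. I, Comparison Theorem (2.8) with the localisation (2.10),
Cor. (2.14); in the Dobrushin–Shlosman window setting of 1985, Theorem 1). Window data of `γ` as in
`abs_integral_sub_integral_le_window_weighted_of_dlrOn`; `γ'` a second specification with
`∫ G dγ'_{win c}(σ) = ∫ G dγ_{win c}(σ)` for every usable centre (`P c`), every `σ` and every bounded measurable
`G`; `μ ∈ G(γ)`, `ν ∈ G(γ')`; profile `ρ` as there. Then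
`|∫ f dμ − ∫ f dν| ≤ R Σ_{x ∈ Δf} e^{−t ρ(x)} δf x`. [cite: Follmer1988, Ch. I Theorem (2.8) and (2.10)] -/
theorem abs_integral_sub_integral_le_window_weighted_pair [DecidableEq V] {γ γ' : Specification V S}
    (hγ : IsSpecification γ) (hγ' : IsSpecification γ')
    {r : S → S → ℝ} {R : ℝ} (hr0 : ∀ a b, 0 ≤ r a b) (hrR : ∀ a b, r a b ≤ R) (hR : 0 ≤ R)
    (hrr : ∀ a, r a a = 0)
    {win : V → Finset V} {K : V → V → V → ℝ} (hK0 : ∀ c y x, 0 ≤ K c y x)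
    (hcontract : ∀ (c : V) (ω η : V → S) (f : (V → S) → ℝ) (δ : V → ℝ), Measurable f →
      (∃ B, ∀ σ, |f σ| ≤ B) → DependsOn f (win c : Set V) → (∀ x, 0 ≤ δ x) →
      (∀ (x : V) (σ τ : V → S), (∀ v, v ≠ x → σ v = τ v) → |f σ - f τ| ≤ δ x * r (σ x) (τ x)) →
        |∫ σ, f σ ∂(γ (win c) ω) - ∫ σ, f σ ∂(γ (win c) η)| ≤
          ∑ x ∈ win c, δ x * ∑' y, K c y x * r (ω y) (η y))
    {t : ℝ} (ht : 0 ≤ t) {d : V → V → V → ℝ} (hd0 : ∀ c y x, 0 ≤ d c y x)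
    (hKs : ∀ c x, Summable fun y => K c y x * Real.exp (t * d c y x))
    {γ₀ : ℝ} (hγ₀ : 0 ≤ γ₀) (hγ₁ : γ₀ < 1)
    (hsumW : ∀ c, ∀ x ∈ win c, ∑' y, K c y x * Real.exp (t * d c y x) ≤ γ₀)
    {μ ν : Measure (V → S)} (hμ : IsGibbsMeasure γ μ) (hν : IsGibbsMeasure γ' ν) (Λ : Finset V) (P : V → Prop)
    (hagree : ∀ c, P c → ∀ (σ : V → S) ⦃G : (V → S) → ℝ⦄, Measurable G → (∃ B, ∀ τ, |G τ| ≤ B) →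
      ∫ τ, G τ ∂(γ' (win c) σ) = ∫ τ, G τ ∂(γ (win c) σ))
    {f : (V → S) → ℝ} (hfm : Measurable f) {Bf : ℝ} (hBf : ∀ σ, |f σ| ≤ Bf)
    {Δf : Finset V} (hfdep : DependsOn f (Δf : Set V)) {δf : V → ℝ} (hδf : IsLipBound r f δf)
    (hΔf : Δf ⊆ Λ) (ρ : V → ℝ) (hρout : ∀ y, y ∉ Λ → ρ y ≤ 0)
    (hρunc : ∀ x ∈ Λ, (∀ c ∈ Λ, win c ⊆ Λ → P c → x ∉ win c) → ρ x ≤ 0)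
    (hρ : ∀ c ∈ Λ, win c ⊆ Λ → P c → ∀ x ∈ win c, ∀ y, K c y x ≠ 0 → ρ x ≤ ρ y + d c y x) :
    |∫ σ, f σ ∂μ - ∫ σ, f σ ∂ν| ≤ R * ∑ x ∈ Δf, Real.exp (-(t * ρ x)) * δf x := by
  haveI := hν.isProbabilityMeasure
  refine abs_integral_sub_integral_le_window_weighted_of_dlrOn hγ hr0 hrR hR hrr hK0 hcontract ht hd0 hKs hγ₀ hγ₁
    hsumW hμ Λ P (fun c _ _ hPc G hGm hGb => ?_) hfm hBf hfdep hδf hΔf ρ hρout hρunc hρ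
  -- `ν(γ_{win c} G) = ν(γ'_{win c} G) = ν(G)`: the kernels agree at a usable centre, then DLR for `γ'`
  obtain ⟨B, hB⟩ := hGb
  have h1 : (fun σ => ∫ τ, G τ ∂(γ (win c) σ)) = fun σ => ∫ τ, G τ ∂(γ' (win c) σ) :=
    funext fun σ => (hagree c hPc σ hGm ⟨B, hB⟩).symm
  rw [h1]
  exact hν.integral_integral_eq hγ' (win c) (integrable_of_abs_le' hGm hB)

/-- **Exponential form**: in the setting of `abs_integral_sub_integral_le_window_weighted_pair`, if moreover `ρ ≥ m`
on `Δf`, then `|∫ f dμ − ∫ f dν| ≤ R e^{−t m} Σ_{x ∈ Δf} δf x`. [cite: Follmer1988, Ch. I Corollary (2.14)] -/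
theorem abs_integral_sub_integral_le_window_weighted_pair_exp [DecidableEq V] {γ γ' : Specification V S}
    (hγ : IsSpecification γ) (hγ' : IsSpecification γ')
    {r : S → S → ℝ} {R : ℝ} (hr0 : ∀ a b, 0 ≤ r a b) (hrR : ∀ a b, r a b ≤ R) (hR : 0 ≤ R)
    (hrr : ∀ a, r a a = 0)
    {win : V → Finset V} {K : V → V → V → ℝ} (hK0 : ∀ c y x, 0 ≤ K c y x)
    (hcontract : ∀ (c : V) (ω η : V → S) (f : (V → S) → ℝ) (δ : V → ℝ), Measurable f →
      (∃ B, ∀ σ, |f σ| ≤ B) → DependsOn f (win c : Set V) → (∀ x, 0 ≤ δ x) →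
      (∀ (x : V) (σ τ : V → S), (∀ v, v ≠ x → σ v = τ v) → |f σ - f τ| ≤ δ x * r (σ x) (τ x)) →
        |∫ σ, f σ ∂(γ (win c) ω) - ∫ σ, f σ ∂(γ (win c) η)| ≤
          ∑ x ∈ win c, δ x * ∑' y, K c y x * r (ω y) (η y))
    {t : ℝ} (ht : 0 ≤ t) {d : V → V → V → ℝ} (hd0 : ∀ c y x, 0 ≤ d c y x)
    (hKs : ∀ c x, Summable fun y => K c y x * Real.exp (t * d c y x))
    {γ₀ : ℝ} (hγ₀ : 0 ≤ γ₀) (hγ₁ : γ₀ < 1)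
    (hsumW : ∀ c, ∀ x ∈ win c, ∑' y, K c y x * Real.exp (t * d c y x) ≤ γ₀)
    {μ ν : Measure (V → S)} (hμ : IsGibbsMeasure γ μ) (hν : IsGibbsMeasure γ' ν) (Λ : Finset V) (P : V → Prop)
    (hagree : ∀ c, P c → ∀ (σ : V → S) ⦃G : (V → S) → ℝ⦄, Measurable G → (∃ B, ∀ τ, |G τ| ≤ B) →
      ∫ τ, G τ ∂(γ' (win c) σ) = ∫ τ, G τ ∂(γ (win c) σ))
    {f : (V → S) → ℝ} (hfm : Measurable f) {Bf : ℝ} (hBf : ∀ σ, |f σ| ≤ Bf)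
    {Δf : Finset V} (hfdep : DependsOn f (Δf : Set V)) {δf : V → ℝ} (hδf : IsLipBound r f δf)
    (hΔf : Δf ⊆ Λ) (ρ : V → ℝ) (hρout : ∀ y, y ∉ Λ → ρ y ≤ 0)
    (hρunc : ∀ x ∈ Λ, (∀ c ∈ Λ, win c ⊆ Λ → P c → x ∉ win c) → ρ x ≤ 0)
    (hρ : ∀ c ∈ Λ, win c ⊆ Λ → P c → ∀ x ∈ win c, ∀ y, K c y x ≠ 0 → ρ x ≤ ρ y + d c y x)
    {m : ℝ} (hm : ∀ x ∈ Δf, m ≤ ρ x) :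
    |∫ σ, f σ ∂μ - ∫ σ, f σ ∂ν| ≤ R * Real.exp (-(t * m)) * ∑ x ∈ Δf, δf x := by
  have h := abs_integral_sub_integral_le_window_weighted_pair hγ hγ' hr0 hrR hR hrr hK0 hcontract ht hd0 hKs hγ₀ hγ₁
    hsumW hμ hν Λ P hagree hfm hBf hfdep hδf hΔf ρ hρout hρunc hρ
  refine h.trans ?_
  have hθ : ∑ x ∈ Δf, Real.exp (-(t * ρ x)) * δf x ≤ Real.exp (-(t * m)) * ∑ x ∈ Δf, δf x := by
    rw [Finset.mul_sum]
    refine Finset.sum_le_sum fun x hx => mul_le_mul_of_nonneg_right ?_ (hδf.nonneg x)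
    exact Real.exp_le_exp.2 (by nlinarith [hm x hx, ht])
  calc R * ∑ x ∈ Δf, Real.exp (-(t * ρ x)) * δf x ≤ R * (Real.exp (-(t * m)) * ∑ x ∈ Δf, δf x) :=
        mul_le_mul_of_nonneg_left hθ hR
    _ = R * Real.exp (-(t * m)) * ∑ x ∈ Δf, δf x := by ring

end Literature.Probability.LatticeModels.DobrushinShlosman

end
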